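import Mathlib
import Summits.Ventures.PercRepro2.Defs
import Summits.Ventures.PercRepro2.Graph
import Summits.Ventures.PercRepro2.Events
import Summits.Ventures.PercRepro2.Harris
import Summits.Ventures.PercRepro2.XWForm
import Summits.Ventures.PercRepro2.XWCoincide
import Summits.Ventures.PercRepro2.XWCoincideUO

/-!
# (XW) holds at every placement of the marks with a coincidence (PercRepro2, p2 g24)

The six coincidences of two of the four marks `s, y, o, u` of (XW) are all settled on every
graph: `s = u`, `y = o`, `s = y` are identities (`XW = 0`), `u = y` and `o = s` are Harris, `u = o`
is an Ahlswede–Daykin instance (`XWCoincide.lean`, `XWCoincideUO.lean`).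
**`xwBil_nonneg_of_coincidence`** collects them: (XW) holds whenever two marks coincide — so (XW)
is open only for four distinct marks.  Own work; standard axioms.
-/

namespace Summit.Ventures.PercRepro2

namespace XWCoincideAll

variable {V : Type*} {E : Type*} [Fintype E] [DecidableEq E]
  {R : Type*} [CommRing R] [LinearOrder R] [IsStrictOrderedRing R]

/-- **(XW) at every placement with a coincidence**: if two of the four marks coincide, then
`0 ≤ xwBil ends s y o u p p`. -/
theorem xwBil_nonneg_of_coincidence (ends : E → Sym2 V) (s y o u : V) {p : E → R}
    (hp : IsProbVec p) (h : s = y ∨ s = o ∨ s = u ∨ y = o ∨ y = u ∨ o = u) :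
    0 ≤ xwBil ends s y o u p p := by
  rcases h with rfl | rfl | rfl | rfl | rfl | rfl
  · rw [XWCoincideUO.xwBil_eq_zero_of_s_eq_y]
  · exact XWCoincide.xwBil_nonneg_of_o_eq_s ends s y u hp
  · rw [XWCoincide.xwBil_eq_zero_of_s_eq_u]
  · rw [XWCoincide.xwBil_eq_zero_of_y_eq_o]
  · exact XWCoincide.xwBil_nonneg_of_u_eq_y ends s y o hp
  · exact XWCoincideUO.xwBil_nonneg_of_u_eq_o ends s y o hp

end XWCoincideAll

end Summit.Ventures.PercRepro2
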